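/- LEAD seat `ym-line-cbag-p1` (prover-ym-line-cbag-p1-g24-0), route `EguchiKawaiDirectionLadder` (ideator ym-idea-2, LINE 8),
crux K_A `TripleSmallBallMargin` (stmt-QuantumFields-27724), architecture note ARCH-27724-lead-g24 §1 (S3): the WEYL SUP BOUND —
the class-function form of Weyl's integral formula for `U(N)` (PROVED in the tree: `WeylIntegration.lintegral_haarProbability_unitaryGroup_
eq_lintegral_diagonalTorus`, Bröcker–tom Dieck IV (1.11)) turned into the `N`-uniform pricing tool of random-matrix small-ball arguments:
`∫ F dHaar_{U(N)} ≤ sup_{t ∈ Δ(N)} w(t) F(t)`, `w(t) = ∏_{j<k} |t_j − t_k|² / N!`.  ROUTE-INDEPENDENT (no Theses import).  Nothing here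
bears on the Yang–Mills mass gap (barrier-ledger line onto `EguchiKawaiBreakdown`). -/
import Literature.RepresentationTheory.CompactGroups.WeylIntegralFormula
import HarnessLib

/-!
# Route `EguchiKawaiDirectionLadder`, crux `TripleSmallBallMargin`: the Weyl sup bound (pricing of class functions)

For a measurable class function `F : U(N) → [0,∞]` (`F(g u g⁻¹) = F(u)`), Weyl's integral formula in the tree's
pushforward/diagonal-torus form reads `∫ F dHaar_{U(N)} = ∫_{Δ(N)} w(t) F(t) dHaar_{Δ(N)}(t)` with the Weyl weight
`w(t) = ∏_i ∏_{j ≠ i} |t_ii − t_jj| / N!` (`WeylIntegration.weylWeight`).  Since `Haar_{Δ(N)}` is a probability measure,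

* `lintegral_haar_le_of_classFunction` — `∫ F dHaar ≤ B` as soon as `w(t) F(t) ≤ B` for every `t ∈ Δ(N)`;
* `weylWeight_eq_ofReal_prod_Ioi` — on `t = diag(d)`, `w(t) = (∏_{j<k} |d_j − d_k|²) / N!` (ordered pairs → unordered pairs,
  `prod_erase_eq_prod_Ioi`), the form in which the per-pair bookkeeping of the line (entrywise rigidity factor `min(1, s/|d_j − d_k|²)`
  against the Vandermonde factor `|d_j − d_k|²`) is done;
* `weylWeight_mul_le_of_pairwise` — the resulting PER-PAIR PRICING: if `F(t) ≤ A · ∏_{j<k} f(j,k)` on `t = diag(d)` and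
  `|d_j − d_k|² · f(j,k) ≤ c` for every pair, then `w(t) F(t) ≤ A · c^{C(N,2)}` (the `1/N! ≤ 1` is dropped).

All [folklore] given Weyl's formula [cite: BrockerTomDieck1985, IV (1.11) (p0163)].
-/

set_option autoImplicit false

noncomputable section

open MeasureTheory
open scoped ENNReal

namespace Summit.QuantumFields.YangMills.Theorems.EguchiKawaiDirectionLadder

open Literature.MathematicalPhysics.QuantumFieldTheory (haarProbability)
open Literature.LinearAlgebra.Matrix (diagonalTorus mem_diagonalTorus_iff)
open Literature.RepresentationTheory.CompactGroups.CompactGroup (isProbabilityMeasure_haarMeasure_top)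
open Literature.RepresentationTheory.CompactGroups.WeylIntegration (weylWeight measurable_weylWeight
  lintegral_haarProbability_unitaryGroup_eq_lintegral_diagonalTorus)

variable {N : ℕ}

/-- The normalised Haar measure of the diagonal torus `Δ(N)` is a probability measure (tree lemma, recorded as a theorem and used
via `haveI`; no instance is declared). [folklore] -/
theorem isProbabilityMeasure_haarProbability_diagonalTorus :
    IsProbabilityMeasure (haarProbability (diagonalTorus (Fin N))) := by
  unfold haarProbability; exact isProbabilityMeasure_haarMeasure_top

/-- **Weyl sup bound.** For a measurable class function `F` on `U(N)`: if `w(t) · F(t) ≤ B` for every diagonal unitary `t`,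
then `∫ F dHaar_{U(N)} ≤ B`. [cite: BrockerTomDieck1985, IV (1.11) (p0163)] -/
theorem lintegral_haar_le_of_classFunction {F : Matrix.unitaryGroup (Fin N) ℂ → ℝ≥0∞} (hF : Measurable F)
    (hcl : ∀ g u : Matrix.unitaryGroup (Fin N) ℂ, F (g * u * g⁻¹) = F u) {B : ℝ≥0∞}
    (hB : ∀ t : diagonalTorus (Fin N), weylWeight t * F (t : Matrix.unitaryGroup (Fin N) ℂ) ≤ B) :
    ∫⁻ u, F u ∂haarProbability (Matrix.unitaryGroup (Fin N) ℂ) ≤ B := by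
  rw [lintegral_haarProbability_unitaryGroup_eq_lintegral_diagonalTorus hF hcl]
  haveI := isProbabilityMeasure_haarProbability_diagonalTorus (N := N)
  calc ∫⁻ t, weylWeight t * F (t : Matrix.unitaryGroup (Fin N) ℂ) ∂haarProbability (diagonalTorus (Fin N))
      ≤ ∫⁻ _, B ∂haarProbability (diagonalTorus (Fin N)) := lintegral_mono fun t => hB t
    _ = B := by rw [lintegral_const, measure_univ, mul_one]

/-- **Weyl sup bound for events.** For a measurable conjugation-invariant event `S ⊆ U(N)`: if `w(t) ≤ B` for every diagonal
unitary `t ∈ S`, then `Haar(S) ≤ B`. [cite: BrockerTomDieck1985, IV (1.11) (p0163)] -/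
theorem haar_le_of_conjInvariant {S : Set (Matrix.unitaryGroup (Fin N) ℂ)} (hS : MeasurableSet S)
    (hcl : ∀ g u : Matrix.unitaryGroup (Fin N) ℂ, g * u * g⁻¹ ∈ S ↔ u ∈ S) {B : ℝ≥0∞}
    (hB : ∀ t : diagonalTorus (Fin N), (t : Matrix.unitaryGroup (Fin N) ℂ) ∈ S → weylWeight t ≤ B) :
    haarProbability (Matrix.unitaryGroup (Fin N) ℂ) S ≤ B := by
  rw [← lintegral_indicator_one hS]
  have hmeas : Measurable (S.indicator (1 : Matrix.unitaryGroup (Fin N) ℂ → ℝ≥0∞)) :=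
    measurable_one.indicator hS
  refine lintegral_haar_le_of_classFunction hmeas (fun g u => ?_) fun t => ?_
  · by_cases hu : u ∈ S
    · rw [Set.indicator_of_mem hu, Set.indicator_of_mem ((hcl g u).2 hu), Pi.one_apply, Pi.one_apply]
    · rw [Set.indicator_of_notMem hu, Set.indicator_of_notMem (fun h => hu ((hcl g u).1 h))]
  · by_cases ht : (t : Matrix.unitaryGroup (Fin N) ℂ) ∈ S
    · rw [Set.indicator_of_mem ht, Pi.one_apply, mul_one]; exact hB t ht
    · rw [Set.indicator_of_notMem ht, mul_zero]; exact bot_le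

/-! ### Ordered versus unordered pairs -/

/-- The number of unordered pairs: `Σ_j #{k > j} = C(N, 2)`. [folklore] -/
theorem sum_card_Ioi_eq_choose_two (N : ℕ) : ∑ j : Fin N, (Finset.Ioi j).card = N.choose 2 := by
  have h : ∀ j : Fin N, (Finset.Ioi j).card = N - 1 - (j : ℕ) := fun j => Fin.card_Ioi j
  simp_rw [h]
  rw [Fin.sum_univ_eq_sum_range (fun i => N - 1 - i) N, Finset.sum_range_reflect (fun i => i) N,
    Finset.sum_range_id, Nat.choose_two_right]

/-- `∏_i ∏_{j ≠ i} a i j = ∏_j ∏_{k > j} (a j k · a k j)`. [folklore] -/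
theorem prod_erase_eq_prod_Ioi {α : Type*} [CommMonoid α] (a : Fin N → Fin N → α) :
    ∏ i, ∏ j ∈ Finset.univ.erase i, a i j = ∏ j, ∏ k ∈ Finset.Ioi j, (a j k * a k j) := by
  have hsplit : ∀ i : Fin N, ∏ j ∈ Finset.univ.erase i, a i j =
      (∏ j ∈ Finset.Ioi i, a i j) * ∏ j ∈ Finset.Iio i, a i j := by
    intro i
    have hunion : Finset.univ.erase i = Finset.Ioi i ∪ Finset.Iio i := by
      ext j
      simp only [Finset.mem_erase, Finset.mem_univ, and_true, Finset.mem_union, Finset.mem_Ioi, Finset.mem_Iio]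
      rcases lt_trichotomy i j with h | h | h
      · simp [h, ne_of_gt h]
      · simp [h]
      · simp [h, ne_of_lt h]
    rw [hunion, Finset.prod_union]
    rw [Finset.disjoint_left]
    intro j hj hj'
    exact lt_asymm (Finset.mem_Ioi.1 hj) (Finset.mem_Iio.1 hj')
  simp_rw [hsplit, Finset.prod_mul_distrib]
  congr 1
  -- `∏_i ∏_{j < i} a i j = ∏_j ∏_{k > j} a k j`
  exact Finset.prod_comm' (fun i j => by simp [Finset.mem_Ioi, Finset.mem_Iio])

/-- `∏_i ∏_{j ≠ i} ‖d i − d j‖ = ∏_j ∏_{k>j} ‖d j − d k‖²` (the Weyl weight as a product over unordered pairs). [folklore] -/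
theorem prod_erase_norm_sub_eq (d : Fin N → ℂ) :
    ∏ i, ∏ j ∈ Finset.univ.erase i, ‖d i - d j‖ = ∏ j, ∏ k ∈ Finset.Ioi j, ‖d j - d k‖ ^ 2 := by
  rw [prod_erase_eq_prod_Ioi]
  refine Finset.prod_congr rfl fun j _ => Finset.prod_congr rfl fun k _ => ?_
  rw [norm_sub_rev (d k) (d j), sq]

/-- The diagonal entries of a diagonal-torus element `t = diag(d)`. [folklore] -/
theorem diagonalTorus_apply_eq {t : diagonalTorus (Fin N)} {d : Fin N → ℂ}
    (hd : ((t : Matrix.unitaryGroup (Fin N) ℂ) : Matrix (Fin N) (Fin N) ℂ) = Matrix.diagonal d) (i : Fin N) :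
    ((t : Matrix.unitaryGroup (Fin N) ℂ) : Matrix (Fin N) (Fin N) ℂ) i i = d i := by
  rw [hd, Matrix.diagonal_apply_eq]

/-- **The Weyl weight over unordered pairs**: on `t = diag(d)`, `w(t) = (∏_{j<k} |d_j − d_k|²) / N!`.
[cite: BrockerTomDieck1985, IV (1.11) (p0163)] -/
theorem weylWeight_eq_ofReal_prod_Ioi {t : diagonalTorus (Fin N)} {d : Fin N → ℂ}
    (hd : ((t : Matrix.unitaryGroup (Fin N) ℂ) : Matrix (Fin N) (Fin N) ℂ) = Matrix.diagonal d) :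
    weylWeight t = ENNReal.ofReal ((∏ j, ∏ k ∈ Finset.Ioi j, ‖d j - d k‖ ^ 2) / (N.factorial : ℝ)) := by
  unfold weylWeight
  simp_rw [diagonalTorus_apply_eq hd]
  rw [prod_erase_norm_sub_eq, Fintype.card_fin]

/-- Every diagonal-torus element is `diag(d)` for some `d` with `|d_i| = 1`. [folklore] -/
theorem exists_diagonalTorus_eq_diagonal (t : diagonalTorus (Fin N)) :
    ∃ d : Fin N → ℂ, ((t : Matrix.unitaryGroup (Fin N) ℂ) : Matrix (Fin N) (Fin N) ℂ) = Matrix.diagonal d ∧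
      ∀ i, ‖d i‖ = 1 := by
  obtain ⟨d, hd⟩ := (mem_diagonalTorus_iff).1 t.2
  exact ⟨d, hd, Literature.LinearAlgebra.Matrix.norm_eq_one_of_mem_diagonalTorus hd⟩

/-- **Per-pair pricing.** If on `t = diag(d)` a class-function value is bounded by `A · ∏_{j<k} f j k` with
`|d_j − d_k|² · f j k ≤ c` (and `0 ≤ f`, `0 ≤ A`), then `w(t) · (that value) ≤ A · c^{C(N,2)}`. [folklore] -/
theorem weylWeight_mul_le_of_pairwise {t : diagonalTorus (Fin N)} {d : Fin N → ℂ}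
    (hd : ((t : Matrix.unitaryGroup (Fin N) ℂ) : Matrix (Fin N) (Fin N) ℂ) = Matrix.diagonal d)
    {F : ℝ≥0∞} {A c : ℝ} {f : Fin N → Fin N → ℝ} (hA : 0 ≤ A) (hf : ∀ j k, 0 ≤ f j k)
    (hF : F ≤ ENNReal.ofReal (A * ∏ j, ∏ k ∈ Finset.Ioi j, f j k))
    (hc : ∀ j k, k ∈ Finset.Ioi j → ‖d j - d k‖ ^ 2 * f j k ≤ c) :
    weylWeight t * F ≤ ENNReal.ofReal (A * c ^ N.choose 2) := by
  rw [weylWeight_eq_ofReal_prod_Ioi hd]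
  have hV : 0 ≤ ∏ j, ∏ k ∈ Finset.Ioi j, ‖d j - d k‖ ^ 2 :=
    Finset.prod_nonneg fun j _ => Finset.prod_nonneg fun k _ => by positivity
  have hdiv : (∏ j, ∏ k ∈ Finset.Ioi j, ‖d j - d k‖ ^ 2) / (N.factorial : ℝ) ≤
      ∏ j, ∏ k ∈ Finset.Ioi j, ‖d j - d k‖ ^ 2 := by
    refine div_le_self hV ?_
    exact_mod_cast Nat.one_le_iff_ne_zero.mpr (Nat.factorial_ne_zero N)
  calc ENNReal.ofReal ((∏ j, ∏ k ∈ Finset.Ioi j, ‖d j - d k‖ ^ 2) / (N.factorial : ℝ)) * F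
      ≤ ENNReal.ofReal (∏ j, ∏ k ∈ Finset.Ioi j, ‖d j - d k‖ ^ 2) *
          ENNReal.ofReal (A * ∏ j, ∏ k ∈ Finset.Ioi j, f j k) :=
        mul_le_mul (ENNReal.ofReal_le_ofReal hdiv) hF bot_le bot_le
    _ = ENNReal.ofReal (A * ∏ j, ∏ k ∈ Finset.Ioi j, (‖d j - d k‖ ^ 2 * f j k)) := by
        rw [← ENNReal.ofReal_mul hV]
        congr 1
        simp_rw [Finset.prod_mul_distrib]
        ring
    _ ≤ ENNReal.ofReal (A * c ^ N.choose 2) := by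
        refine ENNReal.ofReal_le_ofReal (mul_le_mul_of_nonneg_left ?_ hA)
        have hcount : ∑ j : Fin N, (Finset.Ioi j).card = N.choose 2 := sum_card_Ioi_eq_choose_two N
        calc ∏ j, ∏ k ∈ Finset.Ioi j, (‖d j - d k‖ ^ 2 * f j k)
            ≤ ∏ j, ∏ k ∈ Finset.Ioi j, c := by
              refine Finset.prod_le_prod (fun j _ => Finset.prod_nonneg fun k _ =>
                mul_nonneg (by positivity) (hf j k)) fun j _ => ?_
              exact Finset.prod_le_prod (fun k _ => mul_nonneg (by positivity) (hf j k)) fun k hk => hc j k hk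
          _ = c ^ N.choose 2 := by
              simp_rw [Finset.prod_const, Finset.prod_pow_eq_pow_sum, hcount]

end Summit.QuantumFields.YangMills.Theorems.EguchiKawaiDirectionLadder

end
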